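import Literature.Geometry.Lorentzian.CauchyDevelopment
import Literature.Geometry.Lorentzian.LorentzianDistance
import Literature.Geometry.Lorentzian.Hypersurface
import Literature.Geometry.Lorentzian.Einstein
import Literature.Geometry.Lorentzian.NullInfinity
import Literature.Geometry.Lorentzian.Geodesic
import Literature.Geometry.Lorentzian.GeodesicExtension
import Literature.Geometry.Lorentzian.Causality
import Literature.Geometry.Lorentzian.CausalFutureProofs
import Literature.Geometry.Lorentzian.NonImprisonmentProofs
import Literature.Geometry.Lorentzian.GlobalHyperbolicityStrongCausalityProofs
import Literature.Geometry.Lorentzian.FutureNullCompleteness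
import Literature.Geometry.Lorentzian.TimeSeparationPrefix
import Literature.Geometry.Lorentzian.GeodesicRayEndpoint
import Literature.Geometry.Lorentzian.CausalCurveLengthBound

/-!
# The crush of the swallowed interior (registered stub `stub_crush`, line `crush-the-swallowed-interior`, crux
`PhotonSphereChannels.TameCensorship`, item stmt-FinalStateConjecture-10047)

If the swallowed region `J⁺(ιK)` of a maximal vacuum Cauchy development `𝒟` is *crushable* — covered up to a compact `C` by
`I⁺(S″)`, `S″ = range f` the closed achronal range of a uniformly contracting (`H ≤ -ε < 0`) smooth spacelike immersion `f`
with smooth future unit normal, future Cauchy for its own future (`J⁺(S″) ⊆ D⁺(S″)`, the FAITHFUL `D⁺` written out over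
`IsPastEndless`) — then **(C1)** no point of `J⁺(ιK)` is immortal and **(C2)** no future-complete normalised null ray from the
data hypersurface meets `J⁺(ιK)` on its future half. Proved (`stub_crush_of`, `stub_crush`) CONDITIONALLY on two published
facts taken as hypotheses: (hA) Hawking's length bound for a uniformly contracting spacelike FUTURE-CAUCHY hypersurface
(O'Neill 1983, Ch. 14, Thm. 55A p. 431 with Ex. 14.9(a); Wald 1984 Thm 9.5.1; Hawking–Ellis 1973 §8.2 Thm 4), and (hG)
Geroch's theorem (a spacetime with a Cauchy hypersurface is globally hyperbolic; Geroch 1970 Thm 11, O'Neill Cor. 14.39,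
Bernal–Sánchez 2007), plus the line's conjectural NULL TERMINALITY (hypothesis 3, registered separately as
`stub_nullTerminality`). Mechanism: (C1) strong causality (from hG + Bernal–Sánchez, tree) bounds the length of causal
segments inside the compact `C` (`IsStronglyCausal.exists_arcLength_le_of_isCompact`); an immortal `m` yields a causal curve
from `m` inside `J⁺(ιK) ⊆ C ∪ I⁺(S″)` longer than that bound plus `3/ε`; split it at the last exit from `J⁺(S″)`: the first
part lies in `C`, the second starts in `J⁺(f y)` and is bounded by `d(f y, ·) ≤ 3/ε` (hA + the prefix lemma
`arcLength_le_lorentzDist_of_mem_causalFuture`). (C2) a complete ray meeting `J⁺(ιK)` stays in `C ∪ I⁺(S″)`; entering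
`I⁺(S″) ⊆ D⁺(S″)` hands it to null terminality; otherwise it is a future-endless (`not_tendsto_atTop_of_isGeodesicOn`) causal
curve imprisoned in the compact `C`, against non-imprisonment (`…exists_forall_notMem_of_isCompact_holds`).
Stub-worker of the line lead prover-line-stmt-FinalStateConjecture-10047-0, 2026-08-16. [folklore]
-/

-- `maxSynthPendingDepth 2`: instance search on the nested operator space `E →L[ℝ] E →L[ℝ] ℝ`
-- (the model fibre of the bundle of bilinear forms) needs one more pending level than the default.
set_option maxSynthPendingDepth 2
-- the summit-side namespace `Summit.FinalStateConjecture.FinalStateConjecture.…` (summit = problem)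
-- repeats a component by design (D-0022), which the `dupNamespace` linter would flag on every decl.
set_option linter.dupNamespace false

noncomputable section

open Bundle Set Filter Function MeasureTheory Metric
open scoped Manifold ContDiff Topology ENNReal NNReal
open Literature.Geometry.Lorentzian Literature.Geometry.Riemannian

namespace Summit.FinalStateConjecture.FinalStateConjecture.Theorems.PhotonSphereChannels.TameCensorshipCrush

/-- **The crush, conditional form** (`stub_crush` of the line `crush-the-swallowed-interior`
with its unused Wald-form first hypothesis replaced by two named facts; see the module docstring
for their sources and for the proof):
`hA` = O'Neill 1983, Thm. 14.55A (Hawking's bound for a uniformly contracting spacelike *future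
Cauchy* hypersurface, future form, tree rendering à la `HawkingCrushBound`), `hG` = O'Neill 1983,
Cor. 14.39 / Geroch 1970 (a spacetime with a Cauchy hypersurface is globally hyperbolic); then
the registered signature from its second hypothesis on, verbatim: null terminality, and for a
maximal vacuum Cauchy development with a crushable swallowed region the conclusions (C1) no
immortal swallowed point, (C2) no future-complete normalised null ray meets the swallowed region
on its future half. -/
theorem stub_crush_of
    (hA : ∀ (𝓢 : Spacetime.{0} 4) [𝓢.metric.HasLeviCivita],
      𝓢.metric.SatisfiesTimelikeConvergence →
      ∀ (N : Type) [TopologicalSpace N] [ChartedSpace E3 N] [IsManifold (𝓡 3) ∞ N]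
        (f : N → 𝓢.carrier)
        (hpb : PseudoRiemannianMetric.contMDiff_pullbackBilin (𝓡 4) 𝓢.carrier (𝓡 3) N ∞)
        (hf : 𝓢.metric.IsSpacelikeImmersion (𝓡 3) f) (ν : NormalField (𝓡 4) f),
        ContMDiff (𝓡 3) (𝓡 4).tangent ∞
          (fun y ↦ (TotalSpace.mk' E4 (f y) (ν y) : TangentBundle (𝓡 4) 𝓢.carrier)) →
        𝓢.metric.IsFutureUnitNormal (𝓡 3) 𝓢.timeOrientation f ν →
        IsClosed (Set.range f) → 𝓢.metric.IsAchronal 𝓢.timeOrientation (Set.range f) →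
        𝓢.metric.causalFuture 𝓢.timeOrientation (Set.range f) ⊆
          {p : 𝓢.carrier | ∀ (β : ℝ → 𝓢.carrier) (s : Set ℝ), s.OrdConnected →
            𝓢.metric.IsFutureCausalCurveOn 𝓢.timeOrientation β s → IsPastEndless β s →
            ∀ t₀ ∈ s, β t₀ = p → ∃ t ∈ s, t ≤ t₀ ∧ β t ∈ Set.range f} →
        ∀ C : ℝ, 0 < C → (∀ y, 𝓢.metric.meanCurvature f hpb hf ν y ≤ -C) →
        ∀ (y : N) (q : 𝓢.carrier), 𝓢.lorentzDist (f y) q ≤ ENNReal.ofReal (3 / C))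
    (hG : ∀ (𝓢 : Spacetime.{0} 4) (S : Set 𝓢.carrier),
      𝓢.metric.IsCauchyHypersurface 𝓢.timeOrientation S →
      𝓢.metric.IsGloballyHyperbolic 𝓢.timeOrientation) :
    (∀ (Y : Type) [TopologicalSpace Y] [ChartedSpace E3 Y] [IsManifold (𝓡 3) ∞ Y] [T2Space Y]
      [SecondCountableTopology Y] [ConnectedSpace Y] (DY : InitialDataSet (𝓡 3) Y)
      (𝒟 : VacuumCauchyDevelopment DY), 𝒟.IsMaximal → ∀ [𝒟.metric.HasLeviCivita]
      (N : Type) [TopologicalSpace N] [ChartedSpace E3 N] [IsManifold (𝓡 3) ∞ N] (f : N → 𝒟.carrier)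
      (hpb : PseudoRiemannianMetric.contMDiff_pullbackBilin (𝓡 4) 𝒟.carrier (𝓡 3) N ∞)
      (hf : 𝒟.metric.IsSpacelikeImmersion (𝓡 3) f) (ν : NormalField (𝓡 4) f),
      ContMDiff (𝓡 3) (𝓡 4).tangent ∞
        (fun y ↦ (TotalSpace.mk' E4 (f y) (ν y) : TangentBundle (𝓡 4) 𝒟.carrier)) →
      𝒟.metric.IsFutureUnitNormal (𝓡 3) 𝒟.timeOrientation f ν →
      IsClosed (Set.range f) → 𝒟.metric.IsAchronal 𝒟.timeOrientation (Set.range f) →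
      ∀ ε : ℝ, 0 < ε → (∀ y, 𝒟.metric.meanCurvature f hpb hf ν y ≤ -ε) →
      ∀ (γ : ℝ → 𝒟.carrier) (dom : Set ℝ), IsMaximalGeodesicOn 𝒟.metric.leviCivita γ dom →
        (∃ t ∈ dom, 𝒟.metric.IsNull (velocity (𝓡 4) γ t) ∧
          𝒟.timeOrientation.IsFutureDirected (velocity (𝓡 4) γ t)) →
        (∃ t₀ ∈ dom, ∀ t ∈ dom, t₀ ≤ t →
          γ t ∈ {p : 𝒟.carrier | ∀ (β : ℝ → 𝒟.carrier) (s : Set ℝ), s.OrdConnected → 𝒟.metric.IsFutureCausalCurveOn 𝒟.timeOrientation β s → IsPastEndless β s → ∀ t₀ ∈ s, β t₀ = p → ∃ t ∈ s, t ≤ t₀ ∧ β t ∈ Set.range f}) →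
        BddAbove dom) →
    ∀ (X : Type) [TopologicalSpace X] [ChartedSpace E3 X] [IsManifold (𝓡 3) ∞ X] [T2Space X]
      [SecondCountableTopology X] [ConnectedSpace X] (D : InitialDataSet (𝓡 3) X)
      (𝒟 : VacuumCauchyDevelopment D), 𝒟.IsMaximal → ∀ [𝒟.metric.HasLeviCivita] (K : Set X)
      (N : Type) [TopologicalSpace N] [ChartedSpace E3 N] [IsManifold (𝓡 3) ∞ N]
      (f : N → 𝒟.carrier)
      (hpb : PseudoRiemannianMetric.contMDiff_pullbackBilin (𝓡 4) 𝒟.carrier (𝓡 3) N ∞)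
      (hf : 𝒟.metric.IsSpacelikeImmersion (𝓡 3) f) (ν : NormalField (𝓡 4) f) (ε : ℝ),
      0 < ε →
      ContMDiff (𝓡 3) (𝓡 4).tangent ∞
        (fun y ↦ (TotalSpace.mk' E4 (f y) (ν y) : TangentBundle (𝓡 4) 𝒟.carrier)) →
      𝒟.metric.IsFutureUnitNormal (𝓡 3) 𝒟.timeOrientation f ν →
      (∀ y, 𝒟.metric.meanCurvature f hpb hf ν y ≤ -ε) →
      IsClosed (Set.range f) → 𝒟.metric.IsAchronal 𝒟.timeOrientation (Set.range f) →
      𝒟.metric.causalFuture 𝒟.timeOrientation (Set.range f) ⊆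
        {p : 𝒟.carrier | ∀ (β : ℝ → 𝒟.carrier) (s : Set ℝ), s.OrdConnected → 𝒟.metric.IsFutureCausalCurveOn 𝒟.timeOrientation β s → IsPastEndless β s → ∀ t₀ ∈ s, β t₀ = p → ∃ t ∈ s, t ≤ t₀ ∧ β t ∈ Set.range f} →
      ∀ C : Set 𝒟.carrier, IsCompact C →
      𝒟.metric.causalFuture 𝒟.timeOrientation (𝒟.embed '' K) ⊆
        C ∪ 𝒟.metric.chronologicalFuture 𝒟.timeOrientation (Set.range f) →
      (∀ m ∈ 𝒟.metric.causalFuture 𝒟.timeOrientation (𝒟.embed '' K),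
        ¬ ∀ τ : ℝ≥0, ∃ q : 𝒟.carrier, (τ : ℝ≥0∞) < 𝒟.toSpacetime.lorentzDist m q) ∧
      ∀ (p : X) (γ : ℝ → 𝒟.carrier) (dom : Set ℝ),
        𝒟.metric.IsNormalisedNullRayFrom 𝒟.timeOrientation 𝒟.embed 𝒟.normal p γ dom →
        ¬ BddAbove dom →
        γ '' (dom ∩ Set.Ici 0) ∩ 𝒟.metric.causalFuture 𝒟.timeOrientation (𝒟.embed '' K) = ∅ := by
  intro hN X _ _ _ _ _ _ D 𝒟 hmax _ K N _ _ _ f hpb hf ν ε hε hν hun hHle hcl hach hDp C hC hcov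
  -- the development: vacuum, hence timelike convergence; Cauchy hypersurface, hence (hG)
  -- strongly causal and globally hyperbolic; smooth Levi-Civita connection
  have hvac : 𝒟.metric.toPseudoRiemannianMetric.IsRicciFlat := 𝒟.isRicciFlat
  have htc : 𝒟.metric.SatisfiesTimelikeConvergence :=
    LorentzianMetric.satisfiesTimelikeConvergence_of_isRicciFlat hvac
  have hgh : 𝒟.metric.IsGloballyHyperbolic 𝒟.timeOrientation :=
    hG 𝒟.toSpacetime (Set.range 𝒟.embed) 𝒟.isCauchyHypersurface
  have hA' : ∀ (y : N) (q : 𝒟.carrier), 𝒟.lorentzDist (f y) q ≤ ENNReal.ofReal (3 / ε) :=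
    hA 𝒟.toSpacetime htc N f hpb hf ν hν hun hcl hach hDp ε hε hHle
  haveI : CovariantDerivative.ContMDiffCovariantDerivative 𝒟.metric.leviCivita 1 :=
    ⟨𝒟.metric.isLocallyContMDiff_leviCivita_holds 1 (by exact_mod_cast le_top) univ isOpen_univ⟩
  haveI : CovariantDerivative.ContMDiffCovariantDerivative 𝒟.metric.leviCivita (⊤ : ℕ∞) :=
    ⟨𝒟.metric.isLocallyContMDiff_leviCivita_holds ⊤ le_rfl univ isOpen_univ⟩
  have hn1 : (1 : ℕ∞ω) ≤ (∞ : ℕ∞ω) := WithTop.coe_le_coe.mpr le_top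
  have hn2 : (2 : ℕ∞ω) ≤ (∞ : ℕ∞ω) := WithTop.coe_le_coe.mpr le_top
  -- strong causality (Bernal–Sánchez 2007, Thm. 3.2, proved in the tree)
  have hsc : 𝒟.metric.IsStronglyCausal 𝒟.timeOrientation :=
    LorentzianMetric.bernalSanchez_isStronglyCausal_of_isGloballyHyperbolic_holds
      (g := 𝒟.metric) (τ := 𝒟.timeOrientation) hn2 hgh
  -- notation
  set g := 𝒟.metric with hg
  set τ := 𝒟.timeOrientation with hτ
  set S : Set 𝒟.carrier := Set.range f with hS
  set JK : Set 𝒟.carrier := g.causalFuture τ (𝒟.embed '' K) with hJK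
  -- transitivity of `≤` along a causal curve: later points are in `J⁺` of earlier ones
  have hseg : ∀ {γ : ℝ → 𝒟.carrier} {s : Set ℝ} (_ : g.IsFutureCausalCurveOn τ γ s)
      (_ : s.OrdConnected) {t t' : ℝ} (_ : t ∈ s) (_ : t' ∈ s) (_ : t ≤ t'),
      γ t' ∈ g.causalFuture τ {γ t} := by
    intro γ s hγ hs t t' ht ht' htt'
    rcases eq_or_lt_of_le htt' with h | h
    · rw [← h]
      exact LorentzianMetric.subset_causalFuture g τ _ (mem_singleton _)
    · exact Or.inr ⟨γ t, rfl, γ, t, t', h, hγ.mono (hs.out ht ht'), rfl, rfl⟩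
  have htrans : ∀ {A : Set 𝒟.carrier} {x y : 𝒟.carrier} (_ : x ∈ g.causalFuture τ A)
      (_ : y ∈ g.causalFuture τ {x}), y ∈ g.causalFuture τ A := by
    intro A x y hx hy
    have h := LorentzianMetric.causalFuture_mono (singleton_subset_iff.2 hx) hy
    rwa [LorentzianMetric.causalFuture_causalFuture_eq hn2] at h
  constructor
  · /- **(C1) no immortal point in the swallowed region.** -/
    intro m hm himm
    -- Step 1: a uniform bound `B < ∞` for the length of causal curves inside the compact `C`
    -- (strong causality; `IsStronglyCausal.exists_arcLength_le_of_isCompact`)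
    obtain ⟨B, hBtop, hBle⟩ :=
      LorentzianMetric.IsStronglyCausal.exists_arcLength_le_of_isCompact τ hn1 hsc hC
    -- Step 2: a causal curve from `m` longer than `B + 3/ε`
    have hne : B + ENNReal.ofReal (3 / ε) ≠ ⊤ := ENNReal.add_ne_top.2 ⟨hBtop.ne, ENNReal.ofReal_ne_top⟩
    obtain ⟨q, hq⟩ := himm (B + ENNReal.ofReal (3 / ε)).toNNReal
    rw [ENNReal.coe_toNNReal hne] at hq
    obtain ⟨γ, a, b, hab, hγ, hγa, hγb, hlt⟩ := LorentzianMetric.lt_lorentzDist_iff.1 hq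
    -- Step 3: the curve is swallowed, so it runs in `C ∪ I⁺(S)`
    have hγJ : ∀ t ∈ Icc a b, γ t ∈ JK := fun t ht ↦ by
      have h1 : γ t ∈ g.causalFuture τ {γ a} := hseg hγ ordConnected_Icc ⟨le_rfl, hab.le⟩ ht ht.1
      rw [hγa] at h1
      exact htrans hm h1
    have hinC : ∀ t ∈ Icc a b, γ t ∉ g.causalFuture τ S → γ t ∈ C := fun t ht htS ↦ by
      rcases hcov (hγJ t ht) with h | h
      · exact h
      · exact absurd (LorentzianMetric.chronologicalFuture_subset_causalFuture g τ S h) htS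
    have hup : ∀ t ∈ Icc a b, ∀ t' ∈ Icc a b, t ≤ t' → γ t ∈ g.causalFuture τ S →
        γ t' ∈ g.causalFuture τ S := fun t ht t' ht' htt' htS ↦
      htrans htS (hseg hγ ordConnected_Icc ht ht' htt')
    -- Step 4: after entering `J⁺(S)` the remaining length is at most `3/ε` (hA + prefixing)
    have htailS : ∀ t ∈ Icc a b, γ t ∈ g.causalFuture τ S →
        g.arcLength γ t b ≤ ENNReal.ofReal (3 / ε) := by
      intro t ht htS
      rcases eq_or_lt_of_le ht.2 with h | h
      · rw [h, PseudoRiemannianMetric.arcLength_self]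
        exact zero_le
      · rw [LorentzianMetric.causalFuture_eq_biUnion] at htS
        obtain ⟨x, hx, htx⟩ := mem_iUnion₂.1 htS
        obtain ⟨y, rfl⟩ := hx
        calc g.arcLength γ t b ≤ 𝒟.lorentzDist (f y) (γ b) :=
              LorentzianMetric.arcLength_le_lorentzDist_of_mem_causalFuture hn1 h
                (hγ.mono (Icc_subset_Icc ht.1 le_rfl)) htx
          _ ≤ ENNReal.ofReal (3 / ε) := hA' y (γ b)
    -- Step 5: the total length is at most `B + 3/ε`
    have hbound : g.arcLength γ a b ≤ B + ENNReal.ofReal (3 / ε) := by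
      set N' : Set ℝ := {t | t ∈ Icc a b ∧ γ t ∉ g.causalFuture τ S} with hN'def
      by_cases hN' : N'.Nonempty
      · have hN'bdd : BddAbove N' := ⟨b, fun t ht ↦ ht.1.2⟩
        set u := sSup N' with hu
        have hau : a ≤ u := by
          obtain ⟨t, ht⟩ := hN'
          exact ht.1.1.trans (le_csSup hN'bdd ht)
        have hub : u ≤ b := csSup_le hN' fun t ht ↦ ht.1.2
        have haN : γ a ∉ g.causalFuture τ S := by
          obtain ⟨t, ht⟩ := hN'
          exact fun haS ↦ ht.2 (hup a ⟨le_rfl, hab.le⟩ t ht.1 ht.1.1 haS)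
        have hbelow : ∀ t, a ≤ t → t < u → γ t ∉ g.causalFuture τ S := by
          intro t hat htu htS
          obtain ⟨t', ht'N, htt'⟩ := exists_lt_of_lt_csSup hN' htu
          exact ht'N.2 (hup t ⟨hat, htt'.le.trans ht'N.1.2⟩ t' ht'N.1 htt'.le htS)
        have huC : γ u ∈ C := by
          by_cases huS : γ u ∈ g.causalFuture τ S
          · have hau' : a < u := lt_of_le_of_ne hau fun h ↦ haN (by rw [h]; exact huS)
            have hcu : ContinuousAt γ u := (hγ u ⟨hau, hub⟩).1.continuousAt
            have hmem : ∀ᶠ t in 𝓝[<] u, γ t ∈ C := by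
              filter_upwards [Ioo_mem_nhdsLT hau'] with t ht
              exact hinC t ⟨ht.1.le, ht.2.le.trans hub⟩ (hbelow t ht.1.le ht.2)
            exact hC.isClosed.mem_of_tendsto
              (hcu.tendsto.mono_left nhdsWithin_le_nhds) hmem
          · exact hinC u ⟨hau, hub⟩ huS
        have h1 : g.arcLength γ a u ≤ B := by
          refine hBle γ a u hau (hγ.mono (Icc_subset_Icc le_rfl hub)) fun t ht ↦ ?_
          rcases eq_or_lt_of_le ht.2 with h | h
          · rw [h]; exact huC
          · exact hinC t ⟨ht.1, h.le.trans hub⟩ (hbelow t ht.1 h)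
        have h2 : g.arcLength γ u b ≤ ENNReal.ofReal (3 / ε) := by
          rcases eq_or_lt_of_le hub with h | h
          · rw [h, PseudoRiemannianMetric.arcLength_self]
            exact zero_le
          · refine PseudoRiemannianMetric.arcLength_le_of_forall_lt h fun t hut htb ↦
              htailS t ⟨hau.trans hut.le, htb.le⟩ ?_
            by_contra htS
            have : t ≤ u := le_csSup hN'bdd ⟨⟨hau.trans hut.le, htb.le⟩, htS⟩
            linarith
        calc g.arcLength γ a b = g.arcLength γ a u + g.arcLength γ u b :=
              (PseudoRiemannianMetric.arcLength_add γ hau hub).symm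
          _ ≤ B + ENNReal.ofReal (3 / ε) := add_le_add h1 h2
      · have haS : γ a ∈ g.causalFuture τ S := by
          by_contra h
          exact hN' ⟨a, ⟨le_rfl, hab.le⟩, h⟩
        calc g.arcLength γ a b ≤ ENNReal.ofReal (3 / ε) := htailS a ⟨le_rfl, hab.le⟩ haS
          _ ≤ B + ENNReal.ofReal (3 / ε) := le_add_self
    exact absurd hlt (not_lt.2 hbound)
  · /- **(C2) no future-complete normalised null ray meets the swallowed region.** -/
    intro p γ dom hray hunb
    rw [Set.eq_empty_iff_forall_notMem]
    rintro x ⟨⟨t₁, ⟨ht₁dom, ht₁0⟩, rfl⟩, hxJ⟩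
    obtain ⟨hmaxg, h0dom, -, hnull0, hfut0, -⟩ := hray
    have hopen : IsOpen dom := hmaxg.isOpen
    have hoc : dom.OrdConnected := hmaxg.2.1
    have hgeo : IsGeodesicOn g.leviCivita γ dom := hmaxg.isGeodesicOn
    -- the velocity is null and future-directed everywhere; the ray is a causal curve
    have hnf : ∀ t ∈ dom, g.IsNull (velocity (𝓡 4) γ t) ∧ τ.IsFutureDirected (velocity (𝓡 4) γ t) :=
      fun t ht ↦ IsGeodesicOn.isNull_and_isFutureDirected_velocity g τ hopen hoc hgeo h0dom
        hnull0 hfut0 ht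
    have hcausal : g.IsFutureCausalCurveOn τ γ dom := fun t ht ↦
      ⟨IsGeodesicOn.mdifferentiableAt_holds hgeo ht, (hnf t ht).2⟩
    -- the affine domain contains `[t₁, ∞)`
    have hdom : ∀ t, t₁ ≤ t → t ∈ dom := by
      intro t ht
      obtain ⟨d, hd, htd⟩ : ∃ d ∈ dom, t ≤ d := by
        by_contra h
        push Not at h
        exact hunb ⟨t, fun d hd ↦ (h d hd).le⟩
      exact hoc.out ht₁dom hd ⟨ht, htd⟩
    -- beyond `t₁` the ray is swallowed
    have hJ : ∀ t, t₁ ≤ t → γ t ∈ JK := fun t ht ↦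
      htrans hxJ (hseg hcausal hoc ht₁dom (hdom t ht) ht)
    by_cases hI : ∃ t, t₁ ≤ t ∧ γ t ∈ g.chronologicalFuture τ S
    · -- Case A: the ray enters `I⁺(S) ⊆ J⁺(S) ⊆ D⁺(S)`: null terminality bounds `dom`
      obtain ⟨t₂, ht₂, ht₂I⟩ := hI
      refine hunb (hN X D 𝒟 hmax N f hpb hf ν hν hun hcl hach ε hε hHle γ dom hmaxg
        ⟨0, h0dom, hnull0, hfut0⟩ ⟨t₂, hdom t₂ ht₂, fun t ht htt ↦ hDp ?_⟩)
      exact htrans (LorentzianMetric.chronologicalFuture_subset_causalFuture g τ S ht₂I)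
        (hseg hcausal hoc (hdom t₂ ht₂) ht htt)
    · -- Case B: the ray stays in the compact set `C` for ever: non-imprisonment
      push Not at hI
      have hinC : ∀ t, t₁ ≤ t → γ t ∈ C := fun t ht ↦ (hcov (hJ t ht)).resolve_right (hI t ht)
      have hend : IsFutureEndless γ (Ici t₁) := by
        refine ⟨nonempty_Ici, fun P hP ↦ ?_⟩
        rw [hasFutureEndpoint_iff_tendsto_atTop Subset.rfl] at hP
        -- translate the ray to start at parameter `0`
        set β : ℝ → 𝒟.carrier := fun s ↦ γ (s - -t₁) with hβ
        have hβgeo : IsGeodesicOn g.leviCivita β ((fun s ↦ s - -t₁) ⁻¹' dom) :=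
          hgeo.comp_sub_const (-t₁)
        have hβo : IsOpen ((fun s : ℝ ↦ s - -t₁) ⁻¹' dom) :=
          hopen.preimage (continuous_id.sub continuous_const)
        have hβc : ((fun s : ℝ ↦ s - -t₁) ⁻¹' dom).OrdConnected := by
          refine ⟨fun a ha c hc u hu ↦ ?_⟩
          show u - -t₁ ∈ dom
          exact hoc.out ha hc ⟨by linarith [hu.1], by linarith [hu.2]⟩
        have hβsub : Ici (0 : ℝ) ⊆ (fun s : ℝ ↦ s - -t₁) ⁻¹' dom := fun s hs ↦ by
          show s - -t₁ ∈ dom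
          exact hdom _ (by rw [sub_neg_eq_add]; linarith [mem_Ici.1 hs])
        have hβv : velocity (𝓡 4) β 0 ≠ 0 := by
          rw [hβ, velocity_comp_sub_const γ (-t₁) 0, zero_sub, neg_neg]
          exact (hnf t₁ ht₁dom).1.2
        have hshift : Tendsto (fun s : ℝ ↦ s - -t₁) atTop atTop := by
          have : (fun s : ℝ ↦ s - -t₁) = fun s ↦ s + t₁ := funext fun s ↦ sub_neg_eq_add s t₁
          rw [this]
          exact tendsto_atTop_add_const_right _ t₁ tendsto_id
        exact not_tendsto_atTop_of_isGeodesicOn (cov := g.leviCivita) hβo hβc hβsub hβgeo hβv P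
          (hP.comp hshift)
      obtain ⟨t, ht, hfar⟩ :=
        LorentzianMetric.IsStronglyCausal.exists_forall_notMem_of_isCompact_holds
          (g := g) (τ := τ) hn2 hsc hC ordConnected_Ici (hcausal.mono fun s hs ↦ hdom s hs) hend
      exact hfar t ht le_rfl (hinC t ht)


/-- **The crush** — REGISTERED stub `stub_crush` of the line `crush-the-swallowed-interior` for the crux
`PhotonSphereChannels.TameCensorship` (stmt-FinalStateConjecture-10047), in its registered def-free form: from Hawking's
bound for a uniformly contracting spacelike future-Cauchy hypersurface (O'Neill 1983 Thm 14.55A, hypothesis 1) and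
Geroch's theorem (Cauchy hypersurface ⇒ globally hyperbolic, hypothesis 2) and null terminality (hypothesis 3, the line's
soft lemma), a crushable swallowed region `J⁺(ι''K)` of a maximal vacuum Cauchy development hosts no immortal point and
meets no future-complete normalised null ray. Proof: `stub_crush_of`. [folklore] -/
theorem stub_crush :
    (∀ (𝓢 : Spacetime.{0} 4) [𝓢.metric.HasLeviCivita],
      𝓢.metric.SatisfiesTimelikeConvergence →
      ∀ (N : Type) [TopologicalSpace N] [ChartedSpace E3 N] [IsManifold (𝓡 3) ∞ N]
        (f : N → 𝓢.carrier)
        (hpb : PseudoRiemannianMetric.contMDiff_pullbackBilin (𝓡 4) 𝓢.carrier (𝓡 3) N ∞)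
        (hf : 𝓢.metric.IsSpacelikeImmersion (𝓡 3) f) (ν : NormalField (𝓡 4) f),
        ContMDiff (𝓡 3) (𝓡 4).tangent ∞
          (fun y ↦ TotalSpace.mk' E4 (f y) (ν y)) →
        𝓢.metric.IsFutureUnitNormal (𝓡 3) 𝓢.timeOrientation f ν →
        IsClosed (range f) → 𝓢.metric.IsAchronal 𝓢.timeOrientation (range f) →
        𝓢.metric.causalFuture 𝓢.timeOrientation (range f) ⊆
          {p : 𝓢.carrier | ∀ (β : ℝ → 𝓢.carrier) (s : Set ℝ), s.OrdConnected →
            𝓢.metric.IsFutureCausalCurveOn 𝓢.timeOrientation β s → IsPastEndless β s →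
            ∀ t₀ ∈ s, β t₀ = p → ∃ t ∈ s, t ≤ t₀ ∧ β t ∈ range f} →
        ∀ C : ℝ, 0 < C → (∀ y, 𝓢.metric.meanCurvature f hpb hf ν y ≤ -C) →
        ∀ y q, 𝓢.lorentzDist (f y) q ≤ ENNReal.ofReal (3 / C)) →
    (∀ (𝓢 : Spacetime.{0} 4) S,
      𝓢.metric.IsCauchyHypersurface 𝓢.timeOrientation S →
      𝓢.metric.IsGloballyHyperbolic 𝓢.timeOrientation) →
    (∀ (Y : Type) [TopologicalSpace Y] [ChartedSpace E3 Y] [IsManifold (𝓡 3) ∞ Y] [T2Space Y]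
      [SecondCountableTopology Y] [ConnectedSpace Y] (DY : InitialDataSet (𝓡 3) Y)
      (𝒟 : VacuumCauchyDevelopment DY), 𝒟.IsMaximal → ∀ [𝒟.metric.HasLeviCivita]
      (N : Type) [TopologicalSpace N] [ChartedSpace E3 N] [IsManifold (𝓡 3) ∞ N] (f : N → 𝒟.carrier)
      (hpb : PseudoRiemannianMetric.contMDiff_pullbackBilin (𝓡 4) 𝒟.carrier (𝓡 3) N ∞)
      (hf : 𝒟.metric.IsSpacelikeImmersion (𝓡 3) f) (ν : NormalField (𝓡 4) f),
      ContMDiff (𝓡 3) (𝓡 4).tangent ∞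
        (fun y ↦ TotalSpace.mk' E4 (f y) (ν y)) →
      𝒟.metric.IsFutureUnitNormal (𝓡 3) 𝒟.timeOrientation f ν →
      IsClosed (range f) → 𝒟.metric.IsAchronal 𝒟.timeOrientation (range f) →
      ∀ ε : ℝ, 0 < ε → (∀ y, 𝒟.metric.meanCurvature f hpb hf ν y ≤ -ε) →
      ∀ (γ : ℝ → 𝒟.carrier) (dom : Set ℝ), IsMaximalGeodesicOn 𝒟.metric.leviCivita γ dom →
        (∃ t ∈ dom, 𝒟.metric.IsNull (velocity (𝓡 4) γ t) ∧
          𝒟.timeOrientation.IsFutureDirected (velocity (𝓡 4) γ t)) →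
        (∃ t₀ ∈ dom, ∀ t ∈ dom, t₀ ≤ t →
          γ t ∈ {p : 𝒟.carrier | ∀ (β : ℝ → 𝒟.carrier) (s : Set ℝ), s.OrdConnected → 𝒟.metric.IsFutureCausalCurveOn 𝒟.timeOrientation β s → IsPastEndless β s → ∀ t₀ ∈ s, β t₀ = p → ∃ t ∈ s, t ≤ t₀ ∧ β t ∈ range f}) →
        BddAbove dom) →
    ∀ (X : Type) [TopologicalSpace X] [ChartedSpace E3 X] [IsManifold (𝓡 3) ∞ X] [T2Space X]
      [SecondCountableTopology X] [ConnectedSpace X] (D : InitialDataSet (𝓡 3) X)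
      (𝒟 : VacuumCauchyDevelopment D), 𝒟.IsMaximal → ∀ [𝒟.metric.HasLeviCivita] (K : Set X)
      (N : Type) [TopologicalSpace N] [ChartedSpace E3 N] [IsManifold (𝓡 3) ∞ N]
      (f : N → 𝒟.carrier)
      (hpb : PseudoRiemannianMetric.contMDiff_pullbackBilin (𝓡 4) 𝒟.carrier (𝓡 3) N ∞)
      (hf : 𝒟.metric.IsSpacelikeImmersion (𝓡 3) f) (ν : NormalField (𝓡 4) f) (ε : ℝ),
      0 < ε →
      ContMDiff (𝓡 3) (𝓡 4).tangent ∞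
        (fun y ↦ TotalSpace.mk' E4 (f y) (ν y)) →
      𝒟.metric.IsFutureUnitNormal (𝓡 3) 𝒟.timeOrientation f ν →
      (∀ y, 𝒟.metric.meanCurvature f hpb hf ν y ≤ -ε) →
      IsClosed (range f) → 𝒟.metric.IsAchronal 𝒟.timeOrientation (range f) →
      𝒟.metric.causalFuture 𝒟.timeOrientation (range f) ⊆
        {p : 𝒟.carrier | ∀ (β : ℝ → 𝒟.carrier) (s : Set ℝ), s.OrdConnected → 𝒟.metric.IsFutureCausalCurveOn 𝒟.timeOrientation β s → IsPastEndless β s → ∀ t₀ ∈ s, β t₀ = p → ∃ t ∈ s, t ≤ t₀ ∧ β t ∈ range f} →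
      ∀ C, IsCompact C →
      𝒟.metric.causalFuture 𝒟.timeOrientation (𝒟.embed '' K) ⊆
        C ∪ 𝒟.metric.chronologicalFuture 𝒟.timeOrientation (range f) →
      (∀ m ∈ 𝒟.metric.causalFuture 𝒟.timeOrientation (𝒟.embed '' K),
        ¬ ∀ τ : ℝ≥0, ∃ q, (τ : ℝ≥0∞) < 𝒟.toSpacetime.lorentzDist m q) ∧
      ∀ (p : X) (γ : ℝ → 𝒟.carrier) (dom : Set ℝ),
        𝒟.metric.IsNormalisedNullRayFrom 𝒟.timeOrientation 𝒟.embed 𝒟.normal p γ dom →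
        ¬ BddAbove dom →
        γ '' (dom ∩ Ici 0) ∩ 𝒟.metric.causalFuture 𝒟.timeOrientation (𝒟.embed '' K) = ∅ :=
  stub_crush_of

end Summit.FinalStateConjecture.FinalStateConjecture.Theorems.PhotonSphereChannels.TameCensorshipCrush

end
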